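import Summits.ResolutionOfSingularities.ResolutionOfSingularities.Theorems.WildQuotientsSummitReductionStubPairOrbitBlowupCentreNewLemmas
import Summits.ResolutionOfSingularities.ResolutionOfSingularities.Theorems.WildQuotientsSummitReductionStubPairOrbitBlowupCentreNewLemmas2
import Summits.ResolutionOfSingularities.ResolutionOfSingularities.Theorems.WildQuotientsSummitReductionStubPairOrbitBlowupCentreNewOrbitLemmas
import Literature.AlgebraicGeometry.Resolution.AlterationsSemiStableCodimTwoBlowupFormal
import Mathlib.RingTheory.Flat.FaithfullyFlat.Algebra
import HarnessLib

/-!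
# `WildQuotients.SummitReduction` (stmt-ResolutionOfSingularities-16324), line `FramePerfect`, skeleton v8:
# helper lemmas for stub `stub_pair_orbitBlowupCentreNew` (C3) — "completion and blowing up
# commute": the transfer from the blown-up formal node ring to `X₁` (de Jong 1996, 3.4)

Route `ResolutionOfSingularities/WildQuotients`, crux `SummitReduction`; worker file supporting the
registered stub `stub_pair_orbitBlowupCentreNew` of the line skeleton (v8, lead c4).

De Jong 1996, 3.4 (p. 64): "We remark that completion and blowing up commute in a suitable manner,
so that it suffices to compute the blow up of `Spec B'` (3.3) in the ideal `(u, v, t₁)`." This is the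
any-field, any-point analogue of the tree's `DeJong1996.SemiStablePair.blowup_apply_eq_of_formalNodeRing`
(`AlterationsSemiStableCodimTwoBlowupFormal.lean`, stated there for pairs in Situation 4.23 over an
algebraically closed field, at closed points): given a point `z` of `X`, formal coordinates
`e : 𝒪̂_{X,z} ≅ M = K⟦u, v, T⟧/(uv - ∏ Tᵢ^{νᵢ})`, a generization `x' ⤳ z` whose prime completes to
`(u, v, T_{i₀})`, `ν_{i₀} ≥ 2`, and a blow-up `π : X₁ ⟶ X` of a closed `Z ⊆ X` whose stalk ideal at
`z` is that prime, we base change `π` along the flat `ι : Spec M → X` (`IsBlowup.pullback_snd_of_flat`)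
to a blow-up of `Spec M` along `(u, v, T_{i₀})` and read off, from the chart computation of p. 64
(`FormalNodeRing.blowup_triplePrime_singular_over_centre`, `centreNew_blowup_triplePrime_residue`):

* `centreNew_transfer` — every codimension-`≤ 2` singular point `x₁` of `X₁` over `Z` with
  `π x₁ ⤳ z` lies over `x'` and has `dim 𝒪_{X₁,x₁} ≥ 2`, and two such points coincide;
* `centreNew_transfer_residue` — if moreover `(u, v, T_{i₀})` is the maximal ideal of `M` (the case
  `z = x'` of codimension 2), every germ at such an `x₁` is a germ at `z` plus an element of `𝔪_{x₁}`:
  **the new codimension-2 singular point has the residue field of the old one** (the singular point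
  of the exceptional conic is rational, "`u' = v' = t₁ = 0`").
-/

set_option linter.dupNamespace false

noncomputable section

open CategoryTheory CategoryTheory.Limits AlgebraicGeometry TopologicalSpace Topology
open Literature.AlgebraicGeometry.Resolution
open Literature.AlgebraicGeometry
open IsLocalRing Scheme.IdealSheafData DeJong1996.FormalNodeRing

namespace Summit.ResolutionOfSingularities.ResolutionOfSingularities.Theorems

universe u

set_option maxHeartbeats 1600000 in
/-- **"Completion and blowing up commute": the transfer at a point, over any field** (cf.
`DeJong1996.SemiStablePair.blowup_apply_eq_of_formalNodeRing`). Let `π : X₁ ⟶ X` be a blow-up of the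
Noetherian scheme `X` in the ideal sheaf of a closed subset `Z`, `z ∈ X` a point with formal
coordinates `e : 𝒪̂_{X,z} ≅ M = K⟦u, v, T⟧/(uv - ∏ Tᵢ^{νᵢ})`, and `x' ⤳ z` a generization such that
the stalk ideal of `Z` at `z` is the prime `𝔭_{x'}` of `x'`, which completes to `(u, v, T_{i₀})` with
`ν_{i₀} ≥ 2` (3.4 ¶2). Then every codimension-`≤ 2` singular point `x₁` of `X₁` over `Z` with
`π x₁ ⤳ z` has `π x₁ = x'` and `dim 𝒪_{X₁,x₁} ≥ 2`, and two such points are equal. Proof: base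
change along the flat `ι : Spec M → Spec 𝒪_{X,z} → X` gives a blow-up of `Spec M` along
`(u, v, T_{i₀})`; `x₁` lifts to a point `y` generic in its fibre (`exists_preimage_ringKrullDim_stalk_eq`),
non-regular, over `V(u, v, T_{i₀})`; by the chart computation `y` lies over `(u, v, T_{i₀})`, is
unique and has `dim ≥ 2`; and `ι(u, v, T_{i₀}) = x'` (faithful flatness of `𝒪_{X,z} → M`).
[cite: DeJong1996, 3.4, pp. 63–64] -/
theorem centreNew_transfer {X X₁ : Scheme.{u}} [IsNoetherian X] {π : X₁ ⟶ X} {Z : Set X}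
    (hZ : IsClosed Z) (hπ : IsBlowup π (vanishingIdeal ⟨Z, hZ⟩)) {z x' : X} (hx'z : x' ⤳ z)
    {K : Type u} [Field K] {m : ℕ} {ν : Fin m → ℕ} {i₀ : Fin m} (hν : 2 ≤ ν i₀)
    (e : AdicCompletion (maximalIdeal (X.presheaf.stalk z)) (X.presheaf.stalk z) ≃+*
      DeJong1996.FormalNodeRing K m ν)
    (hJ : stalkIdeal (vanishingIdeal ⟨Z, hZ⟩) z = primeOfSpecializes hx'z)
    (hP : ((primeOfSpecializes hx'z).map (algebraMap (X.presheaf.stalk z)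
        (AdicCompletion (maximalIdeal (X.presheaf.stalk z)) (X.presheaf.stalk z)))).map e.toRingHom =
      triplePrime K m ν i₀) :
    (∀ x₁ ∈ Scheme.singularLocusCodimLE X₁ 2, π.base x₁ ∈ Z → π.base x₁ ⤳ z →
        π.base x₁ = x' ∧ (2 : WithBot ℕ∞) ≤ ringKrullDim (X₁.presheaf.stalk x₁)) ∧
      ∀ x₁ ∈ Scheme.singularLocusCodimLE X₁ 2, ∀ x₁' ∈ Scheme.singularLocusCodimLE X₁ 2,
        π.base x₁ ∈ Z → π.base x₁' ∈ Z → π.base x₁ ⤳ z → π.base x₁' ⤳ z → x₁ = x₁' := by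
  classical
  haveI : IsProper π := hπ.isProper
  haveI : IsLocallyNoetherian X₁ := LocallyOfFiniteType.isLocallyNoetherian π
  set T : Closeds X := ⟨Z, hZ⟩ with hT
  -- the flat local ring map `c : 𝒪_{X,z} → 𝒪̂_{X,z} ≅ M`
  let O : CommRingCat.{u} := X.presheaf.stalk z
  let Ô := AdicCompletion (maximalIdeal O) O
  let M := DeJong1996.FormalNodeRing K m ν
  haveI : IsNoetherianRing (MvPowerSeries (Fin 2 ⊕ Fin m) K) :=
    isNoetherianRing_mvPowerSeries K (Fin 2 ⊕ Fin m)
  haveI : IsNoetherianRing M := inferInstanceAs (IsNoetherianRing (_ ⧸ _))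
  haveI : Nontrivial M := e.injective.nontrivial
  haveI : IsLocalRing M := IsLocalRing.of_surjective' (e : Ô →+* M) e.surjective
  haveI hp : (triplePrime K m ν i₀).IsPrime := isPrime_triplePrime K hν
  let c : O ⟶ CommRingCat.of M := CommRingCat.ofHom ((e : Ô →+* M).comp (algebraMap O Ô))
  have hc : c.hom = (e : Ô →+* M).comp (algebraMap O Ô) := rfl
  have hcflat : c.hom.Flat := by
    rw [hc]
    exact RingHom.Flat.comp (RingHom.flat_algebraMap_iff.mpr (AdicCompletion.flat_of_isNoetherian _))
      (RingHom.Flat.of_bijective e.bijective)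
  haveI : IsLocalHom c.hom := by
    rw [hc]
    infer_instance
  have hPc : (primeOfSpecializes hx'z).map c.hom = triplePrime K m ν i₀ := by
    rw [hc, ← Ideal.map_map]
    exact hP
  have hcentre' : (stalkIdeal (vanishingIdeal T) z).map c.hom = triplePrime K m ν i₀ := by
    rw [hT, hJ]
    exact hPc
  -- the flat morphism `ι : Spec M → X` and the base-changed blow-up `ρ`
  let ι : Spec (.of M) ⟶ X := Spec.map c ≫ X.fromSpecStalk z
  haveI : Flat (Spec.map c) := Flat.SpecMap_iff.mpr hcflat
  haveI : Flat (X.fromSpecStalk z) := flat_fromSpecStalk X z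
  haveI : Flat ι := inferInstance
  let φ := pullback.fst π ι
  let ρ := pullback.snd π ι
  haveI : Flat φ := inferInstance
  haveI : IsLocallyNoetherian (pullback π ι) := LocallyOfFiniteType.isLocallyNoetherian ρ
  have hB : IsBlowup ρ (ofIdealTop ((triplePrime K m ν i₀).map (Scheme.ΓSpecIso (.of M)).inv.hom)) := by
    have h1 := hπ.pullback_snd_of_flat ι
    rwa [show ι = Spec.map c ≫ X.fromSpecStalk z from rfl,
      comap_SpecMap_comp_fromSpecStalk_eq_ofIdealTop, hcentre'] at h1
  obtain ⟨-, Hb⟩ := blowup_triplePrime_singular_over_centre K m ν i₀ hν _ ρ hB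
  have Hres := centreNew_blowup_triplePrime_residue K m ν i₀ hν _ ρ hB
  -- `ι` hits every generization of `z`
  have hιsurj : ∀ w : X, w ⤳ z → ∃ q : Spec (.of M), ι.base q = w := by
    intro w hw
    obtain ⟨p, hp⟩ : w ∈ Set.range (X.fromSpecStalk z) := by
      rw [Scheme.range_fromSpecStalk]
      exact hw
    letI : Algebra O M := c.hom.toAlgebra
    haveI : Module.Flat O M := hcflat
    haveI : Module.FaithfullyFlat O M := Module.FaithfullyFlat.of_flat_of_isLocalHom
    obtain ⟨q, hq⟩ := PrimeSpectrum.comap_surjective_of_faithfullyFlat (A := O) (B := M) p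
    refine ⟨q, ?_⟩
    change X.fromSpecStalk z (Spec.map c q) = w
    rw [← hp]
    congr 1
  -- points of `Spec M` over `Z` are the points of `V(𝔭)`
  have hιT : ∀ q : Spec (.of M), ι.base q ∈ (T : Set X) ↔ triplePrime K m ν i₀ ≤ q.asIdeal := by
    intro q
    rw [show ι = Spec.map c ≫ X.fromSpecStalk z from rfl, ← hcentre']
    exact SpecMap_comp_fromSpecStalk_mem_iff z c T q
  -- the lift of a codimension-`≤ 2` singular point over `Z` specializing to `z`
  have lift : ∀ x₁ ∈ Scheme.singularLocusCodimLE X₁ 2, π.base x₁ ∈ Z → π.base x₁ ⤳ z →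
      ∃ y : ↥(pullback π ι), φ.base y = x₁ ∧ triplePrime K m ν i₀ ≤ (ρ.base y).asIdeal ∧
        ¬ IsRegularLocalRing ((pullback π ι).presheaf.stalk y) ∧
        ringKrullDim ((pullback π ι).presheaf.stalk y) ≤ 2 ∧
        ringKrullDim ((pullback π ι).presheaf.stalk y) = ringKrullDim (X₁.presheaf.stalk x₁) := by
    intro x₁ hx₁ hE hsp
    obtain ⟨q, hq⟩ := hιsurj (π.base x₁) hsp
    obtain ⟨y₀, hy₀, -⟩ := Scheme.Pullback.exists_preimage_pullback (f := π) (g := ι) x₁ q hq.symm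
    obtain ⟨y, hy, hdim⟩ := exists_preimage_ringKrullDim_stalk_eq φ (x' := x₁) ⟨y₀, hy₀⟩
    refine ⟨y, hy, ?_, ?_, ?_, hdim⟩
    · rw [← hιT, ← Scheme.Hom.comp_apply, ← pullback.condition, Scheme.Hom.comp_apply]
      change π.base (φ.base y) ∈ Z
      rw [hy]
      exact hE
    · refine not_isRegularLocalRing_stalk_of_flat φ y ?_
      rw [hy]
      exact hx₁.1
    · rw [hdim]
      exact hx₁.2
  -- the image of `𝔭 = (u, v, T_{i₀})` in `X` is `x'`
  let z₀ : Spec (.of M) := ⟨triplePrime K m ν i₀, hp⟩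
  have hz₀ : ι.base z₀ = x' := by
    letI : Algebra O M := c.hom.toAlgebra
    haveI : Module.Flat O M := hcflat
    haveI : Module.FaithfullyFlat O M := Module.FaithfullyFlat.of_flat_of_isLocalHom
    have h1 : (Spec.map c).base z₀ = ⟨primeOfSpecializes hx'z, inferInstance⟩ := by
      apply PrimeSpectrum.ext
      change (triplePrime K m ν i₀).comap c.hom = primeOfSpecializes hx'z
      rw [← hPc]
      exact (primeOfSpecializes hx'z).comap_map_eq_self_of_faithfullyFlat (B := M)
    change (X.fromSpecStalk z).base ((Spec.map c).base z₀) = x'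
    rw [h1]
    exact Motives.fromSpecStalk_comap_maximalIdeal hx'z
  have hover' : ∀ y : ↥(pullback π ι), triplePrime K m ν i₀ ≤ (ρ.base y).asIdeal →
      ¬ IsRegularLocalRing ((pullback π ι).presheaf.stalk y) →
      ringKrullDim ((pullback π ι).presheaf.stalk y) ≤ 2 → π.base (φ.base y) = x' := by
    intro y h1 h2 h3
    have hρy : ρ.base y = z₀ := PrimeSpectrum.ext ((Hres y h1 h2 h3).1)
    rw [← Scheme.Hom.comp_apply, pullback.condition, Scheme.Hom.comp_apply]
    change ι.base (ρ.base y) = x'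
    rw [hρy, hz₀]
  refine ⟨fun x₁ hx₁ hE hsp => ?_, fun x₁ hx₁ x₁' hx₁' hE hE' hsp hsp' => ?_⟩
  · obtain ⟨y, hy, h1, h2, h3, hdim⟩ := lift x₁ hx₁ hE hsp
    refine ⟨?_, ?_⟩
    · rw [← hy]
      exact hover' y h1 h2 h3
    · rw [← hdim]
      exact (Hres y h1 h2 h3).2.1
  · obtain ⟨y, hy, h1, h2, h3, -⟩ := lift x₁ hx₁ hE hsp
    obtain ⟨y', hy', h1', h2', h3', -⟩ := lift x₁' hx₁' hE' hsp'
    rw [← hy, ← hy', Hb y y' h1 h2 h3 h1' h2' h3']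

end Summit.ResolutionOfSingularities.ResolutionOfSingularities.Theorems

end
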